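import Mathlib
import Literature.NumberTheory.Transcendental.LandauDefectLattice
import Literature.NumberTheory.Transcendental.RosenlichtProp4Residues
import Literature.NumberTheory.Transcendental.AxSchanuelUniv
import Literature.NumberTheory.Transcendental.AxSchanuelLieDerivative

/-!
# Horizontal classification of `∇`-stable subspaces (crux `InverseLandauRationalCurves`, stub E)

Support file of item stmt-KontsevichZagierPeriods-13872 (line `Sketch`). Let `D` be a
`k₁`-derivation of a field `K` with constants `k₁` such that every `k₁`-derivation of `K` is a
multiple of `D`, `g : ι → Kˣ` a Landau datum and `∇(b, a) = (Db + Σᵢ aᵢ Dgᵢ/gᵢ, Da)` the Kummer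
connection on `K × K^ι`. A `K`-subspace `N` stable under `∇` meeting the line `K × 0` only in `0`
is spanned by finitely many HORIZONTAL vectors `(κ, c)`: `c` has entries in `k₁`, lies in the
`k₁`-span of the defect lattice `Λ′ = {n | ∏ gᵢ^{nᵢ} algebraic over k₁}`
(`Landau.defectLattice`), and `Dκ + Σ cᵢ Dgᵢ/gᵢ = 0`.

Proof. (A) *Horizontal descent* (the Wronskian lemma, Rosenlicht 1976 Prop. 6, in the form: a
subspace `U ≤ K^ι` stable under coordinatewise `D` is spanned by its `D`-constant vectors — a
non-zero vector of minimal support, normalised to have a coordinate `1`, is constant; induction on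
`dim U`). (B) *Rosenlicht's lattice step*: if `δb + Σ wᵢ δgᵢ/gᵢ = 0` for all `k₁`-derivations `δ`
with `wᵢ ∈ k₁`, then over a `ℚ`-basis `(c_l)` of `Σ ℚ wᵢ` (clearing denominators,
`N wᵢ = Σ_l μ_{il} c_l`) the relation reads `Σ_l c_l δu_l/u_l + δ(Nb) = 0` with
`u_l = ∏ gᵢ^{μ_{il}}`, so by Rosenlicht 1976 Prop. 4 (`Rosenlicht.isAlgebraic_of_forall_derivation`)
the `u_l` are algebraic, i.e. `μ_{·l} ∈ Λ′`, whence `w ∈ k₁ ⊗ Λ′`. (Glue) apply (A) to the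
projection of `N` to `K^ι`, lift each constant vector `c` to `(κ_c, c) ∈ N`; `∇(κ_c, c)` has zero
second component, so its first component vanishes (`N ∩ (K × 0) = 0`), which is horizontality, and
(B) applies because every derivation is a multiple of `D`.

## References
* M. Rosenlicht, *On Liouville's theory of elementary functions*, Pacific J. Math. 65 (1976),
  Props. 4 and 6.
* J. Ax, *On Schanuel's conjectures*, Ann. of Math. 93 (1971), §2.
-/

noncomputable section

open Literature.NumberTheory.Transcendental
open Literature.NumberTheory.Transcendental.AyoubRel

namespace Summit.KontsevichZagierPeriods.InverseLandau.RationalCurves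

/-! ## (A) Horizontal descent: `D`-stable subspaces of `K^ι` are spanned by constant vectors -/

/-- **Horizontal descent, bounded form** (Rosenlicht 1976, Prop. 6, dualised). Let `D : K → K` be
any self-map of a field with `D 0 = 0`, `D 1 = 0`, acting coordinatewise on `K^ι`. Every subspace
`U ≤ K^ι` of dimension `≤ n` stable under `D` is spanned by finitely many of its vectors all of
whose coordinates are killed by `D`. Induction on `n`: a non-zero `w ∈ U` of minimal support with
`w i₀ = 1` has `D ∘ w ∈ U` of strictly smaller support, hence `D ∘ w = 0`; and
`U = K w + (U ∩ {u | u i₀ = 0})`, the second summand being `D`-stable of smaller dimension.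
[cite: Rosenlicht1976, Prop. 6] -/
theorem exists_finset_const_span_of_finrank_le {K : Type*} [Field K] {ι : Type*} [Fintype ι]
    (D : K → K) (hD0 : D 0 = 0) (hD1 : D 1 = 0) :
    ∀ (n : ℕ) (U : Submodule K (ι → K)), Module.finrank K U ≤ n →
      (∀ u ∈ U, (fun i => D (u i)) ∈ U) →
      ∃ s : Finset (ι → K), (↑s : Set (ι → K)) ⊆ U ∧ (∀ u ∈ s, ∀ i, D (u i) = 0) ∧
        U ≤ Submodule.span K (↑s : Set (ι → K)) := by
  classical
  intro n
  induction n with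
  | zero =>
    intro U hU _
    have hbot : U = ⊥ := Submodule.finrank_eq_zero.mp (Nat.le_zero.mp hU)
    exact ⟨∅, by simp, by simp, by simp [hbot]⟩
  | succ n ih =>
    intro U hU hst
    by_cases hbot : U = ⊥
    · exact ⟨∅, by simp, by simp, by simp [hbot]⟩
    -- a non-zero vector of minimal support
    obtain ⟨u₀, hu₀U, hu₀⟩ := (Submodule.ne_bot_iff U).mp hbot
    let sz : (ι → K) → ℕ := fun u => (Finset.univ.filter fun i => u i ≠ 0).card
    have hex : ∃ m, ∃ u, u ∈ U ∧ u ≠ 0 ∧ sz u = m := ⟨sz u₀, u₀, hu₀U, hu₀, rfl⟩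
    obtain ⟨w, hwU, hw0, hwsz⟩ := Nat.find_spec hex
    have hmin : ∀ u, u ∈ U → u ≠ 0 → sz w ≤ sz u := fun u hu hu0 => by
      rw [hwsz]; exact Nat.find_min' hex ⟨u, hu, hu0, rfl⟩
    obtain ⟨i₀, hi₀⟩ := Function.ne_iff.mp hw0
    change w i₀ ≠ 0 at hi₀
    -- normalise: `w' i₀ = 1`
    set w' : ι → K := (w i₀)⁻¹ • w with hw'_def
    have hw'U : w' ∈ U := U.smul_mem _ hwU
    have hw'i : ∀ i, w' i = (w i₀)⁻¹ * w i := fun i => rfl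
    have hw'i₀ : w' i₀ = 1 := by rw [hw'i, inv_mul_cancel₀ hi₀]
    have hw'supp : ∀ i, w' i = 0 ↔ w i = 0 := fun i => by
      rw [hw'i, mul_eq_zero, inv_eq_zero, or_iff_right hi₀]
    -- `D ∘ w' = 0` by minimality of the support
    have hDw' : ∀ i, D (w' i) = 0 := by
      by_contra hne
      push Not at hne
      have hDU : (fun i => D (w' i)) ∈ U := hst w' hw'U
      have hD0' : (fun i => D (w' i)) ≠ 0 := by
        obtain ⟨i, hi⟩ := hne
        exact Function.ne_iff.mpr ⟨i, hi⟩
      have hle := hmin _ hDU hD0'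
      have hlt : sz (fun i => D (w' i)) < sz w := by
        apply Finset.card_lt_card
        rw [Finset.ssubset_iff_of_subset]
        · refine ⟨i₀, by simpa using hi₀, ?_⟩
          simp [hw'i₀, hD1]
        · intro i hi
          simp only [Finset.mem_filter, Finset.mem_univ, true_and] at hi ⊢
          intro hwi
          exact hi (by rw [(hw'supp i).mpr hwi, hD0])
      exact absurd hle (not_le.mpr hlt)
    -- the complement `U₁ = U ∩ {u | u i₀ = 0}`
    set U₁ : Submodule K (ι → K) := U ⊓ LinearMap.ker (LinearMap.proj i₀) with hU₁_def
    have hmemU₁ : ∀ u, u ∈ U₁ ↔ u ∈ U ∧ u i₀ = 0 := fun u => by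
      simp [hU₁_def, Submodule.mem_inf, LinearMap.mem_ker]
    have hU₁lt : U₁ < U := by
      rw [SetLike.lt_iff_le_and_exists]
      refine ⟨inf_le_left, w', hw'U, fun h => ?_⟩
      have := ((hmemU₁ w').mp h).2
      rw [hw'i₀] at this
      exact one_ne_zero this
    have hU₁rank : Module.finrank K U₁ ≤ n :=
      Nat.lt_succ_iff.mp (lt_of_lt_of_le (Submodule.finrank_lt_finrank_of_lt hU₁lt) hU)
    have hU₁st : ∀ u ∈ U₁, (fun i => D (u i)) ∈ U₁ := fun u hu => by
      obtain ⟨huU, hui₀⟩ := (hmemU₁ u).mp hu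
      exact (hmemU₁ _).mpr ⟨hst u huU, by simp only [hui₀, hD0]⟩
    obtain ⟨s₁, hs₁U, hs₁c, hs₁span⟩ := ih U₁ hU₁rank hU₁st
    refine ⟨insert w' s₁, ?_, ?_, ?_⟩
    · rw [Finset.coe_insert, Set.insert_subset_iff]
      exact ⟨hw'U, fun u hu => ((hmemU₁ u).mp (hs₁U hu)).1⟩
    · intro u hu
      rcases Finset.mem_insert.mp hu with rfl | hu
      · exact hDw'
      · exact hs₁c u hu
    · intro u huU
      have hsplit : u = u i₀ • w' + (u - u i₀ • w') := by abel
      rw [hsplit]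
      refine Submodule.add_mem _ (Submodule.smul_mem _ _
        (Submodule.subset_span (Finset.mem_coe.mpr (Finset.mem_insert_self _ _)))) ?_
      have hmem : u - u i₀ • w' ∈ U₁ := by
        refine (hmemU₁ _).mpr ⟨U.sub_mem huU (U.smul_mem _ hw'U), ?_⟩
        simp [hw'i₀]
      exact Submodule.span_mono (by simp [Finset.coe_insert, Set.subset_insert]) (hs₁span hmem)

/-- **Horizontal descent** (Rosenlicht 1976, Prop. 6, dualised): for a self-map `D` of a field
`K` with `D 0 = D 1 = 0` acting coordinatewise on `K^ι` (`ι` finite), a `D`-stable subspace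
`U ≤ K^ι` is the span of finitely many of its `D`-constant vectors. [cite: Rosenlicht1976, Prop. 6] -/
theorem exists_finset_const_span_eq {K : Type*} [Field K] {ι : Type*} [Fintype ι]
    (D : K → K) (hD0 : D 0 = 0) (hD1 : D 1 = 0) (U : Submodule K (ι → K))
    (hU : ∀ u ∈ U, (fun i => D (u i)) ∈ U) :
    ∃ s : Finset (ι → K), (↑s : Set (ι → K)) ⊆ U ∧ (∀ u ∈ s, ∀ i, D (u i) = 0) ∧
      Submodule.span K (↑s : Set (ι → K)) = U := by
  obtain ⟨s, hsU, hsc, hle⟩ :=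
    exists_finset_const_span_of_finrank_le D hD0 hD1 (Module.finrank K U) U le_rfl hU
  exact ⟨s, hsU, hsc, le_antisymm (Submodule.span_le.mpr hsU) hle⟩

/-! ## (B) Rosenlicht's lattice step -/

/-- **Rosenlicht's lattice step** (Rosenlicht 1976, Prop. 4, with the clearing of denominators of
the proof of the Corollary to his Thm. 1; Ax 1971, §2). Let `g : ι → Kˣ`, `w : ι → k₁`, `b ∈ K`
with `δb + Σᵢ wᵢ δgᵢ/gᵢ = 0` for every `k₁`-derivation `δ` of `K` (characteristic zero). Then
`w` lies in the `k₁`-span of the defect lattice `{n ∈ ℤ^ι | ∏ gᵢ^{nᵢ} algebraic over k₁}`: over a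
`ℚ`-basis `(c_l)` of `Σ ℚ wᵢ` with `N wᵢ = Σ_l μ_{il} c_l` (`μ_{il} ∈ ℤ`, `N ≥ 1`) the relation is
`Σ_l c_l δu_l/u_l + δ(N b) = 0`, `u_l = ∏ᵢ gᵢ^{μ_{il}}`, so each `u_l` is algebraic over `k₁`
(Prop. 4), i.e. `μ_{·l}` is in the lattice, and `w = N⁻¹ Σ_l c_l μ_{·l}`.
[cite: Rosenlicht1976, Prop. 4] -/
theorem mem_span_defectLattice_of_forall_derivation
    {k₁ K : Type*} [Field k₁] [CharZero k₁] [Field K] [Algebra k₁ K]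
    {ι : Type*} [Fintype ι] (g : ι → Kˣ) (w : ι → k₁) (b : K)
    (H : ∀ δ : Derivation k₁ K K,
      δ b + ∑ i, algebraMap k₁ K (w i) * ((g i : K)⁻¹ * δ (g i)) = 0) :
    w ∈ Submodule.span k₁ ((fun n : ι → ℤ => fun i => ((n i : ℤ) : k₁)) ''
      (Landau.defectLattice k₁ g : Set (ι → ℤ))) := by
  classical
  -- a `ℚ`-basis of the span of the coefficients, and integer coordinates
  obtain ⟨κ, a, ha, hspan, hli⟩ := exists_linearIndependent' ℚ w
  haveI : Fintype κ := Fintype.ofInjective a ha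
  set c : κ → k₁ := w ∘ a with hc
  have hmem : ∀ i, w i ∈ Submodule.span ℚ (Set.range c) := fun i => by
    rw [hc, hspan]; exact Submodule.subset_span ⟨i, rfl⟩
  obtain ⟨N, hN, hNmem⟩ := exists_common_nsmul_mem_span_int c w hmem
  choose μ hμ using fun i => (Submodule.mem_span_range_iff_exists_fun ℤ).mp (hNmem i)
  -- `hμ i : ∑ l, μ i l • c l = (N : ℤ) • w i`
  have hNw : ∀ i, (N : K) * algebraMap k₁ K (w i) =
      ∑ l, (μ i l : K) * algebraMap k₁ K (c l) := fun i => by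
    have := congrArg (algebraMap k₁ K) (hμ i)
    rw [map_sum, map_zsmul, zsmul_eq_mul, Int.cast_natCast] at this
    rw [← this]
    exact Finset.sum_congr rfl fun l _ => by rw [map_zsmul, zsmul_eq_mul]
  -- the power products `u_l = ∏ gᵢ ^ μ_{il}`
  set u : κ → K := fun l => ∏ i, (g i : K) ^ μ i l with hu
  have hu0 : ∀ l, u l ≠ 0 := fun l =>
    Finset.prod_ne_zero_iff.mpr fun i _ => zpow_ne_zero _ (g i).ne_zero
  have hdlog : ∀ (δ : Derivation k₁ K K) (l : κ),
      (u l)⁻¹ * δ (u l) = ∑ i, (μ i l : K) * ((g i : K)⁻¹ * δ (g i)) := fun δ l =>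
    inv_mul_derivation_prod_zpow δ Finset.univ (fun i => (g i : K)) (fun i _ => (g i).ne_zero)
      fun i => μ i l
  -- the relation over the basis: `Σ_l c_l δu_l/u_l + δ(N b) = 0`
  have H' : ∀ δ : Derivation k₁ K K,
      (∑ l, algebraMap k₁ K (c l) * ((u l)⁻¹ * δ (u l))) + δ ((N : K) * b) = 0 := by
    intro δ
    have h1 : ∑ l, algebraMap k₁ K (c l) * ((u l)⁻¹ * δ (u l)) =
        (N : K) * ∑ i, algebraMap k₁ K (w i) * ((g i : K)⁻¹ * δ (g i)) := by
      calc ∑ l, algebraMap k₁ K (c l) * ((u l)⁻¹ * δ (u l))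
          = ∑ l, ∑ i, (μ i l : K) * algebraMap k₁ K (c l) * ((g i : K)⁻¹ * δ (g i)) := by
            refine Finset.sum_congr rfl fun l _ => ?_
            rw [hdlog, Finset.mul_sum]
            exact Finset.sum_congr rfl fun i _ => by ring
        _ = ∑ i, ∑ l, (μ i l : K) * algebraMap k₁ K (c l) * ((g i : K)⁻¹ * δ (g i)) :=
            Finset.sum_comm
        _ = ∑ i, (N : K) * algebraMap k₁ K (w i) * ((g i : K)⁻¹ * δ (g i)) := by
            refine Finset.sum_congr rfl fun i _ => ?_
            rw [← Finset.sum_mul, hNw]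
        _ = (N : K) * ∑ i, algebraMap k₁ K (w i) * ((g i : K)⁻¹ * δ (g i)) := by
            rw [Finset.mul_sum]
            exact Finset.sum_congr rfl fun i _ => mul_assoc _ _ _
    have h2 : δ ((N : K) * b) = (N : K) * δ b := by
      rw [δ.leibniz, δ.map_natCast, smul_zero, add_zero, smul_eq_mul]
    rw [h1, h2, ← mul_add, add_comm, H δ, mul_zero]
  -- Rosenlicht's Prop. 4: the `u_l` are algebraic over `k₁`
  have halg : ∀ l, IsAlgebraic k₁ (u l) := by
    intro l
    set e := Fintype.equivFin κ with he
    have hli' : LinearIndependent ℚ (c ∘ e.symm) := hli.comp _ e.symm.injective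
    have key := Rosenlicht.isAlgebraic_of_forall_derivation (c ∘ e.symm) hli' (u ∘ e.symm)
      (fun i => hu0 _) ((N : K) * b) (fun δ => by
        rw [← H' δ]
        congr 1
        exact e.symm.sum_comp (fun l => algebraMap k₁ K (c l) * ((u l)⁻¹ * δ (u l)))) (e l)
    simpa using key
  -- so the exponent vectors lie in the defect lattice
  have hlat : ∀ l, (fun i => μ i l) ∈ (Landau.defectLattice k₁ g : Set (ι → ℤ)) := fun l => by
    rw [SetLike.mem_coe, Landau.mem_defectLattice, Landau.val_monomial]
    exact halg l
  -- `N • w` is in the span, hence so is `w`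
  have hNw' : (N : k₁) • w = ∑ l, c l • (fun i => ((μ i l : ℤ) : k₁)) := by
    ext i
    have := hμ i
    rw [zsmul_eq_mul, Int.cast_natCast] at this
    rw [Pi.smul_apply, smul_eq_mul, ← this, Finset.sum_apply]
    exact Finset.sum_congr rfl fun l _ => by
      rw [Pi.smul_apply, smul_eq_mul, zsmul_eq_mul, mul_comm]
  have hNmem' : (N : k₁) • w ∈ Submodule.span k₁ ((fun n : ι → ℤ => fun i => ((n i : ℤ) : k₁)) ''
      (Landau.defectLattice k₁ g : Set (ι → ℤ))) := by
    rw [hNw']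
    exact Submodule.sum_mem _ fun l _ =>
      Submodule.smul_mem _ _ (Submodule.subset_span ⟨_, hlat l, rfl⟩)
  have hw : w = (N : k₁)⁻¹ • ((N : k₁) • w) := by
    rw [smul_smul, inv_mul_cancel₀ (Nat.cast_ne_zero.mpr hN), one_smul]
  rw [hw]
  exact Submodule.smul_mem _ _ hNmem'

/-! ## The classification -/

/-- **Horizontal classification.** Let `D` be a `k₁`-derivation of the field `K` whose constants
are `k₁` and such that every `k₁`-derivation of `K` is a multiple of `D`; let `g : ι → Kˣ` be a
Landau datum and `∇(b, a) = (Db + Σᵢ aᵢ·Dgᵢ/gᵢ, Da)` the Kummer connection on `K × K^ι`. A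
`K`-subspace `N` stable under `∇` and meeting the line `K × 0` only in `0` is spanned by finitely
many of its vectors `(κ, c)` with `c` constant (entries in `k₁`), `c` in the `k₁`-span of the
defect lattice `Λ′ = {n | ∏ gᵢ^{nᵢ} algebraic over k₁}`, and `Dκ + Σ cᵢ Dgᵢ/gᵢ = 0`
(Wronskian lemma of minimal support + Rosenlicht 1976 Prop. 4: horizontal descent
`exists_finset_const_span_eq` on the projection of `N` to `K^ι`, lift of each constant vector to
`N`, vanishing of the first component of its `∇` by `N ∩ (K × 0) = 0`, and
`mem_span_defectLattice_of_forall_derivation`). [cite: Rosenlicht1976, Prop. 4] -/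
theorem stub_horizontalClassification
    {k₁ K : Type*} [Field k₁] [CharZero k₁] [Field K] [Algebra k₁ K]
    (D : Derivation k₁ K K)
    (hconst : ∀ x : K, D x = 0 → x ∈ Set.range (algebraMap k₁ K))
    (hDer : ∀ δ : Derivation k₁ K K, ∃ f : K, ∀ x, δ x = f * D x)
    {ι : Type*} [Fintype ι] (g : ι → Kˣ)
    (N : Submodule K (K × (ι → K)))
    (hN : ∀ v ∈ N,
      ((D v.1 + ∑ i, v.2 i * ((g i : K)⁻¹ * D (g i)), fun i => D (v.2 i)) : K × (ι → K)) ∈ N)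
    (hline : ∀ b : K, ((b, 0) : K × (ι → K)) ∈ N → b = 0) :
    ∃ s : Finset (K × (ι → K)), (↑s : Set (K × (ι → K))) ⊆ N ∧
      Submodule.span K (↑s : Set (K × (ι → K))) = N ∧
      ∀ v ∈ s, (∃ w : ι → k₁, (∀ i, v.2 i = algebraMap k₁ K (w i)) ∧
          w ∈ Submodule.span k₁ ((fun n : ι → ℤ => fun i => ((n i : ℤ) : k₁)) ''
            (Landau.defectLattice k₁ g : Set (ι → ℤ)))) ∧
        D v.1 + ∑ i, v.2 i * ((g i : K)⁻¹ * D (g i)) = 0 := by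
  classical
  -- the projection `U` of `N` to the residue vectors, and its `D`-stability
  set U : Submodule K (ι → K) := N.map (LinearMap.snd K K (ι → K)) with hU_def
  have hUmem : ∀ c, c ∈ U ↔ ∃ b, ((b, c) : K × (ι → K)) ∈ N := fun c => by
    constructor
    · rintro ⟨v, hv, rfl⟩
      exact ⟨v.1, hv⟩
    · rintro ⟨b, hb⟩
      exact ⟨(b, c), hb, rfl⟩
  have hUst : ∀ c ∈ U, (fun i => D (c i)) ∈ U := fun c hc => by
    obtain ⟨b, hb⟩ := (hUmem c).mp hc
    exact (hUmem _).mpr ⟨_, hN _ hb⟩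
  -- (A): `U` is spanned by finitely many constant vectors
  obtain ⟨s₂, hs₂U, hs₂c, hs₂span⟩ :=
    exists_finset_const_span_eq (⇑D) (map_zero D) D.map_one_eq_zero U hUst
  -- lift them to `N`
  choose! κ hκ using fun c (hc : c ∈ U) => (hUmem c).mp hc
  set s : Finset (K × (ι → K)) := s₂.image fun c => (κ c, c) with hs_def
  have hsN : (↑s : Set (K × (ι → K))) ⊆ N := by
    intro v hv
    rw [hs_def, Finset.coe_image] at hv
    obtain ⟨c, hc, rfl⟩ := hv
    exact hκ c (hs₂U hc)
  -- horizontality of the lifts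
  have hhor : ∀ c ∈ s₂, D (κ c) + ∑ i, c i * ((g i : K)⁻¹ * D (g i)) = 0 := fun c hc => by
    apply hline
    have h := hN _ (hκ c (hs₂U hc))
    have h0 : (fun i => D (c i)) = 0 := funext (hs₂c c hc)
    rwa [show (fun i => D (((κ c, c) : K × (ι → K)).2 i)) = 0 from h0] at h
  refine ⟨s, hsN, ?_, ?_⟩
  · -- `span s = N`
    refine le_antisymm (Submodule.span_le.mpr hsN) fun v hv => ?_
    set M : Submodule K (K × (ι → K)) := Submodule.span K (↑s : Set (K × (ι → K))) with hM_def
    have hMN : M ≤ N := Submodule.span_le.mpr hsN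
    have hM2 : M.map (LinearMap.snd K K (ι → K)) = U := by
      rw [hM_def, Submodule.map_span, hs_def, Finset.coe_image, Set.image_image, ← hs₂span]
      congr 1
      simp
    have hv2 : v.2 ∈ M.map (LinearMap.snd K K (ι → K)) := by
      rw [hM2]
      exact (hUmem _).mpr ⟨v.1, hv⟩
    obtain ⟨m, hmM, hm2⟩ := Submodule.mem_map.mp hv2
    have hvm : v - m ∈ N := N.sub_mem hv (hMN hmM)
    have h2 : (v - m).2 = 0 := by
      rw [Prod.snd_sub, sub_eq_zero]
      exact hm2.symm
    have h1 : (v - m).1 = 0 := hline _ (by rwa [← h2])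
    have hv_eq : v = m := by
      rw [← sub_eq_zero]
      exact Prod.ext h1 h2
    rw [hv_eq]
    exact hmM
  · -- the properties of each spanning vector
    intro v hv
    rw [hs_def, Finset.mem_image] at hv
    obtain ⟨c, hc, rfl⟩ := hv
    refine ⟨?_, hhor c hc⟩
    choose w hw using fun i => hconst (c i) (hs₂c c hc i)
    refine ⟨w, fun i => (hw i).symm, mem_span_defectLattice_of_forall_derivation g w (κ c)
      fun δ => ?_⟩
    obtain ⟨f, hf⟩ := hDer δ
    calc δ (κ c) + ∑ i, algebraMap k₁ K (w i) * ((g i : K)⁻¹ * δ (g i))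
        = f * (D (κ c) + ∑ i, c i * ((g i : K)⁻¹ * D (g i))) := by
          rw [hf, mul_add, Finset.mul_sum]
          congr 1
          exact Finset.sum_congr rfl fun i _ => by rw [hf, hw]; ring
      _ = 0 := by rw [hhor c hc, mul_zero]

end Summit.KontsevichZagierPeriods.InverseLandau.RationalCurves

end
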